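import Literature.Computability.QuantumComplexity.PhaseKickProgram
import HarnessLib

/-!
# The Hadamard-sandwich gadget as a Clifford+T circuit

Topic `Literature/Computability/QuantumComplexity`; a step in the discharge of
`ajl_jonesApproxProblem_mem_PromiseBQP`. The circuit whose matrix is the operator `W` analysed in
`HadamardSandwich.lean`/`SandwichBlock.lean`:

  `sandwichCircuit ws c t ops h Fs Fz = H-layer on ws ;  phaseKickCircuit ops h Fs Fz ;  CNOT c→t ;  H-layer reversed`,

with `sandwichCircuit_toMatrix : toMatrix 0 = hadLayerRev ws * (CNOT * phaseDiag (phaseKickExp ops Fs Fz)) * hadLayer ws`,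
oracle-freeness, and the **wire bookkeeping** needed by `OAAWord.lean`: every gate of the circuit acts
inside `ws ∪ {c, t} ∪ wires(ops) ∪ Fs ∪ Fz` (`mem_sandwichWires_of_mem_gates`), via the wire sets of
the compiled reversible words (`mem_wireList_of_mem_compile`).

## References

* D. W. Berry, A. M. Childs, R. Cleve, R. Kothari, R. D. Somma, STOC 2014, §3 [BerryEtAl2014].
* M. A. Nielsen, I. L. Chuang, *Quantum Computation and Quantum Information*, CUP 2010, §4.3
  [NielsenChuang2010].
-/

noncomputable section

namespace Literature.Computability.QuantumComplexity

open _root_.Matrix Cryptography RevSim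

variable {N : ℕ}

/-! ### Wires of the elementary placed gates -/

/-- Wires of `hOn`. [folklore] -/
theorem mem_wires_hOn {i a : Fin N} (h : a ∈ (hOn i).wires) : a = i := by
  simp only [hOn, QGate.wires, Finset.mem_map, Finset.mem_univ, true_and] at h
  obtain ⟨j, hj⟩ := h; exact hj ▸ rfl

/-- Wires of `sOn`. [folklore] -/
theorem mem_wires_sOn {i a : Fin N} (h : a ∈ (sOn i).wires) : a = i := by
  simp only [sOn, QGate.wires, Finset.mem_map, Finset.mem_univ, true_and] at h
  obtain ⟨j, hj⟩ := h; exact hj ▸ rfl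

/-- Wires of `tOn`. [folklore] -/
theorem mem_wires_tOn {i a : Fin N} (h : a ∈ (tOn i).wires) : a = i := by
  simp only [tOn, QGate.wires, Finset.mem_map, Finset.mem_univ, true_and] at h
  obtain ⟨j, hj⟩ := h; exact hj ▸ rfl

/-- Wires of `cnotOn`. [folklore] -/
theorem mem_wires_cnotOn {i j a : Fin N} {hij : i ≠ j} (h : a ∈ (cnotOn i j hij).wires) : a = i ∨ a = j := by
  simp only [cnotOn, QGate.wires, Finset.mem_map, Finset.mem_univ, true_and] at h
  obtain ⟨l, hl⟩ := h
  rw [← hl]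
  rcases l with ⟨_ | _ | n, hn⟩
  · exact Or.inl rfl
  · exact Or.inr rfl
  · exact absurd hn (by simp [cliffordT])

/-! ### Wires of compiled reversible words -/

/-- The wires of a reversible operation. [folklore] -/
def RevOp.wireList : RevOp N → List (Fin N)
  | .not i => [i]
  | .cnot i j _ => [i, j]
  | .toffoli a b c _ _ _ => [a, b, c]

/-- Gates of the `CCZ` word act on `a, b, c`. [folklore] -/
theorem mem_of_mem_wires_cczWord {a b c : Fin N} {hab : a ≠ b} {hac : a ≠ c} {hbc : b ≠ c} {g : QGate cliffordT N}
    (hg : g ∈ cczWord a b c hab hac hbc) {x : Fin N} (hx : x ∈ g.wires) : x ∈ [a, b, c] := by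
  simp only [cczWord, List.mem_cons, List.not_mem_nil, or_false] at hg
  simp only [List.mem_cons, List.not_mem_nil, or_false]
  rcases hg with h | h | h | h | h | h | h | h | h | h | h | h | h | h | h | h | h | h | h | h | h | h <;> subst h <;>
    first
    | exact Or.inl (mem_wires_tOn hx)
    | exact Or.inr (Or.inl (mem_wires_tOn hx))
    | exact Or.inr (Or.inr (mem_wires_tOn hx))
    | exact Or.inr (Or.inl (mem_wires_sOn hx))
    | exact Or.inr (Or.inr (mem_wires_sOn hx))
    | (rcases mem_wires_cnotOn hx with rfl | rfl <;> simp)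

/-- **Gates of a compiled reversible operation act on its wires.** [folklore] -/
theorem mem_wireList_of_mem_compile (op : RevOp N) {g : QGate cliffordT N} (hg : g ∈ op.compile) {x : Fin N}
    (hx : x ∈ g.wires) : x ∈ op.wireList := by
  cases op with
  | not i =>
    simp only [RevOp.compile, xWord, List.mem_cons, List.not_mem_nil, or_false] at hg
    simp only [RevOp.wireList, List.mem_singleton]
    rcases hg with rfl | rfl | rfl | rfl
    · exact mem_wires_hOn hx
    · exact mem_wires_sOn hx
    · exact mem_wires_sOn hx
    · exact mem_wires_hOn hx
  | cnot i j h =>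
    simp only [RevOp.compile, List.mem_singleton] at hg
    subst hg
    simp only [RevOp.wireList, List.mem_cons, List.not_mem_nil, or_false]
    exact mem_wires_cnotOn hx
  | toffoli a b c hab hac hbc =>
    simp only [RevOp.compile, toffoliWord, List.mem_cons, List.mem_append, List.not_mem_nil, or_false] at hg
    show x ∈ [a, b, c]
    rcases hg with rfl | hg | rfl
    · simp [mem_wires_hOn hx]
    · exact mem_of_mem_wires_cczWord hg hx
    · simp [mem_wires_hOn hx]

/-- Gates of a compiled reversible circuit act on the wires of its operations. [folklore] -/
theorem exists_mem_wireList_of_mem_revCompile {ops : List (RevOp N)} {g : QGate cliffordT N} (hg : g ∈ revCompile ops)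
    {x : Fin N} (hx : x ∈ g.wires) : ∃ op ∈ ops, x ∈ op.wireList := by
  rw [revCompile, List.mem_flatMap] at hg
  obtain ⟨op, hop, hg⟩ := hg
  exact ⟨op, hop, mem_wireList_of_mem_compile op hg hx⟩

/-- The wires of `op.toRev h` are the wires of `op`. [folklore] -/
theorem mem_wiresOf_of_mem_wireList_toRev (op : ClOp (Fin N)) (h : op.WF) {x : Fin N} (hx : x ∈ (op.toRev h).wireList) :
    x ∈ wiresOf op := by
  cases op with
  | not i => simp [ClOp.toRev, RevOp.wireList] at hx; simp [wiresOf, ClOp.target, hx]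
  | cnot i j =>
    simp [ClOp.toRev, RevOp.wireList] at hx
    simp only [mem_wiresOf, ClOp.target, ClOp.controls, List.mem_singleton]; tauto
  | toffoli a b c =>
    simp [ClOp.toRev, RevOp.wireList] at hx
    simp only [mem_wiresOf, ClOp.target, ClOp.controls, List.mem_cons, List.not_mem_nil, or_false]; tauto

/-- Gates of `revCompile (toRevList ops h)` act on wires of `ops`. [folklore] -/
theorem exists_mem_wiresOf_of_mem_revCompile_toRevList : ∀ (ops : List (ClOp (Fin N))) (h : ∀ op ∈ ops, op.WF)
    {g : QGate cliffordT N}, g ∈ revCompile (toRevList ops h) → ∀ {x : Fin N}, x ∈ g.wires → ∃ op ∈ ops, x ∈ wiresOf op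
  | [], _, g, hg, x, _ => by simp [toRevList, revCompile] at hg
  | op :: ops, h, g, hg, x, hx => by
    rw [toRevList, revCompile, List.flatMap_cons, List.mem_append] at hg
    rcases hg with hg | hg
    · exact ⟨op, by simp, mem_wiresOf_of_mem_wireList_toRev op _ (mem_wireList_of_mem_compile _ hg hx)⟩
    · obtain ⟨op', hop', hx'⟩ := exists_mem_wiresOf_of_mem_revCompile_toRevList ops _ hg hx
      exact ⟨op', by simp [hop'], hx'⟩

/-! ### The sandwich circuit -/

section Sandwich

variable (ws : List (Fin N)) (c t : Fin N) (hct : c ≠ t) (ops : List (ClOp (Fin N))) (h : ∀ op ∈ ops, op.WF)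
  (Fs Fz : List (Fin N))

/-- **The Hadamard-sandwich circuit.** [cite: BerryEtAl2014, §3] -/
def sandwichCircuit : QCircuit cliffordT N :=
  ((((⟨ws.map hOn⟩ : QCircuit cliffordT N).append (phaseKickCircuit ops h Fs Fz)).append ⟨[cnotOn c t hct]⟩).append
    ⟨(ws.map hOn).reverse⟩)

/-- **Its matrix is the sandwich operator** of `HadamardSandwich.lean`. [cite: BerryEtAl2014, §3] -/
theorem sandwichCircuit_toMatrix :
    (sandwichCircuit ws c t hct ops h Fs Fz).toMatrix 0 =
      hadLayerRev ws * ((cnotOn c t hct).toMatrix 0 * phaseDiag (phaseKickExp ops Fs Fz)) * hadLayer ws := by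
  rw [sandwichCircuit, QCircuit.toMatrix_append, QCircuit.toMatrix_append, QCircuit.toMatrix_append, phaseKickCircuit_toMatrix,
    hadLayerRev, hadLayer, QCircuit.toMatrix_cons, QCircuit.toMatrix_nil, Matrix.one_mul, Matrix.mul_assoc, Matrix.mul_assoc]

/-- The sandwich circuit is oracle-free. [folklore] -/
theorem sandwichCircuit_isOracleFree : (sandwichCircuit ws c t hct ops h Fs Fz).IsOracleFree := by
  intro g hg
  simp only [sandwichCircuit, QCircuit.append, List.mem_append, List.mem_map, List.mem_reverse, List.mem_singleton] at hg
  rcases hg with ((⟨i, _, rfl⟩ | hg) | rfl) | ⟨i, _, rfl⟩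
  · trivial
  · exact phaseKickCircuit_isOracleFree ops h Fs Fz g hg
  · exact cnotOn_isOracleFree c t hct
  · trivial

/-- The wires the sandwich circuit may act on. [folklore] -/
def sandwichWires : List (Fin N) := ws ++ [c, t] ++ ops.flatMap wiresOf ++ Fs ++ Fz

/-- **Every gate of the sandwich circuit acts inside `sandwichWires`.** [folklore] -/
theorem mem_sandwichWires_of_mem_gates {g : QGate cliffordT N} (hg : g ∈ (sandwichCircuit ws c t hct ops h Fs Fz).gates)
    {x : Fin N} (hx : x ∈ g.wires) : x ∈ sandwichWires ws c t ops Fs Fz := by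
  simp only [sandwichWires, List.mem_append, List.mem_cons, List.not_mem_nil, or_false, List.mem_flatMap]
  simp only [sandwichCircuit, QCircuit.append, List.mem_append, List.mem_map, List.mem_reverse, List.mem_singleton] at hg
  rcases hg with ((⟨i, hi, rfl⟩ | hg) | rfl) | ⟨i, hi, rfl⟩
  · exact Or.inl (Or.inl (Or.inl (Or.inl (mem_wires_hOn hx ▸ hi))))
  · simp only [phaseKickCircuit, List.mem_append, sLayer, zLayer, List.mem_map, List.mem_flatMap, List.mem_cons,
      List.not_mem_nil, or_false] at hg
    rcases hg with ((hg | ⟨f, hf, rfl⟩) | ⟨f, hf, (rfl | rfl)⟩) | hg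
    · obtain ⟨op, hop, hx'⟩ := exists_mem_wiresOf_of_mem_revCompile_toRevList ops h hg hx
      exact Or.inl (Or.inl (Or.inr ⟨op, hop, hx'⟩))
    · exact Or.inl (Or.inr (mem_wires_sOn hx ▸ hf))
    · exact Or.inr (mem_wires_sOn hx ▸ hf)
    · exact Or.inr (mem_wires_sOn hx ▸ hf)
    · obtain ⟨op, hop, hx'⟩ := exists_mem_wiresOf_of_mem_revCompile_toRevList ops.reverse (wf_reverse h) hg hx
      exact Or.inl (Or.inl (Or.inr ⟨op, List.mem_reverse.1 hop, hx'⟩))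
  · rcases mem_wires_cnotOn hx with rfl | rfl
    · exact Or.inl (Or.inl (Or.inl (Or.inr (Or.inl rfl))))
    · exact Or.inl (Or.inl (Or.inl (Or.inr (Or.inr rfl))))
  · exact Or.inl (Or.inl (Or.inl (Or.inl (mem_wires_hOn hx ▸ hi))))

end Sandwich

end Literature.Computability.QuantumComplexity

end
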